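import Mathlib.FieldTheory.Extension
import Mathlib.FieldTheory.IsAlgClosed.AlgebraicClosure
import Mathlib.RingTheory.LaurentSeries
import Mathlib.Algebra.MvPolynomial.Equiv
import Mathlib.RingTheory.MvPolynomial.Tower
import Literature.FieldTheory.AlgClosed.NewtonPuiseuxProofs
import Literature.Barriers.ValiantsHypothesis.NumericToSymbolicProp33
import Summits.ValiantsHypothesis.ValiantsHypothesis.Theses.BinomialElusive

/-!
# ValiantsHypothesis / BinomialElusive — `NumericToPuiseux` (numeric-to-formal glue for curves)

Route `BinomialElusive`, item `stmt-ValiantsHypothesis-7396` (support, rank 9): if the binomial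
curve `x ↦ (x^{a_i} + x^{b_i})_i` is contained in the image of a polynomial map
`Γ : ℂ^s → ℂ^m`, then for some `N ≥ 1` there are formal Laurent series `p ∈ ℂ((t))^s`
with `Γ(p(t)) = (t^{N a_i} + t^{N b_i})_i` (`numericToPuiseux_proof`).

The proof composes two results of the tree:

* Garg–Makam–Oliveira–Wigderson 2019, Prop. 3.3 (Nullstellensatz; PROVED:
  `Literature.Barriers.ValiantsHypothesis.GMOW2019_prop33_holds`): pointwise containment
  `im f ⊆ im Γ` gives algebraic functions `b₁(x), …, b_s(x) ∈ \overline{ℂ(x)}` with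
  `f(x) = Γ(b(x))`;
* the Newton–Puiseux theorem (Serre, *Local Fields*, IV §2 Prop. 8; PROVED:
  `Literature.FieldTheory.AlgClosed.NewtonPuiseux_holds`): every polynomial over `k((x))`
  splits over some `k((x^{1/N}))`;

through the classical corollary proved here, `exists_laurent_relation_transfer` (**Puiseux
parametrisation of finitely many algebraic functions**): for
`b₁, …, b_s ∈ \overline{k(x)}` (`k` algebraically closed of characteristic zero) there are
`N ≥ 1` and `p₁, …, p_s ∈ k((t))`
such that every polynomial relation `G(x, b) = 0` over `k` implies `G(tᴺ, p) = 0` — i.e. the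
`k`-algebra `k[x, b₁, …, b_s]` maps to `k((t))` over `x ↦ tᴺ`. Its proof: the minimal
polynomials of the `b_j` over `k(x)`, pushed to `k((x))[T]` along `x ↦ t`, all split in
`k((t))` after one common substitution `x = tᴺ` (Newton–Puiseux applied to their product), so
the field `k(x)(b₁, …, b_s)` embeds into `k((t))` over `x ↦ tᴺ` by Mathlib's extension lemma
`IntermediateField.nonempty_algHom_adjoin_of_splits`.

Vocabulary: `\overline{k(x)}` is `AlgebraicClosure (FractionRing (MvPolynomial (Fin 1) k))`, as
in `GMOW2019_prop33`; `x ↦ tᴺ` on `k((x))` is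
`Literature.Barriers.ResolutionOfSingularities.ramify`. Nothing else is here (no convergence,
no places of function fields).
-/

namespace Summit.ValiantsHypothesis.Theorems

open Polynomial
open HahnSeries (single ofPowerSeries)
open Literature.Barriers.ResolutionOfSingularities (ramify ramify_single)

variable {k : Type} [Field k]

/-- The embedding `k[x] ↪ k((t))`, `x ↦ t` (variables indexed by `Fin 1`): an injective ring
homomorphism sending `X v` to `t = single 1 1` and constants to constants. [folklore] -/
theorem exists_injective_ringHom_mvPolynomial_laurentSeries :
    ∃ g : (MvPolynomial (Fin 1) k) →+* LaurentSeries k, Function.Injective g ∧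
      (∀ v, g (MvPolynomial.X v) = single (1 : ℤ) 1) ∧
      (∀ c, g (MvPolynomial.C c) = HahnSeries.C c) := by
  let e : (MvPolynomial (Fin 1) k) ≃ₐ[k] k[X] := MvPolynomial.uniqueAlgEquiv k (Fin 1)
  let g₀ : k[X] →+* LaurentSeries k :=
    (ofPowerSeries ℤ k).comp (Polynomial.coeToPowerSeries.ringHom : k[X] →+* PowerSeries k)
  refine ⟨g₀.comp e.toRingEquiv.toRingHom, ?_, fun v => ?_, fun c => ?_⟩
  · exact (HahnSeries.ofPowerSeries_injective.comp (Polynomial.coe_injective k)).comp e.injective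
  · show g₀ (e (MvPolynomial.X v)) = single 1 1
    have : e (MvPolynomial.X v) = Polynomial.X := by
      simp [e, MvPolynomial.uniqueAlgEquiv_apply]
    rw [this]
    simp [g₀]
  · show g₀ (e (MvPolynomial.C c)) = HahnSeries.C c
    have : e (MvPolynomial.C c) = Polynomial.C c := by
      simp [e, MvPolynomial.uniqueAlgEquiv_apply]
    rw [this]
    simp [g₀]

/-- The embedding `k(x) ↪ k((t))`, `x ↦ t`, of the rational function field
`FractionRing (MvPolynomial (Fin 1) k)`. [folklore] -/
theorem exists_ringHom_fractionRing_laurentSeries :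
    ∃ ι : (FractionRing (MvPolynomial (Fin 1) k)) →+* LaurentSeries k,
      (∀ v, ι (algebraMap (MvPolynomial (Fin 1) k) (FractionRing (MvPolynomial (Fin 1) k))
        (MvPolynomial.X v)) = single (1 : ℤ) 1) ∧
      (∀ c, ι (algebraMap (MvPolynomial (Fin 1) k) (FractionRing (MvPolynomial (Fin 1) k))
        (MvPolynomial.C c)) = HahnSeries.C c) := by
  obtain ⟨g, hg, hX, hC⟩ := exists_injective_ringHom_mvPolynomial_laurentSeries (k := k)
  refine ⟨IsFractionRing.lift hg, fun v => ?_, fun c => ?_⟩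
  · rw [IsFractionRing.lift_algebraMap, hX]
  · rw [IsFractionRing.lift_algebraMap, hC]

/-- **Puiseux parametrisation of finitely many algebraic functions** (corollary of the
Newton–Puiseux theorem, Serre *Local Fields* IV §2 Prop. 8, via `NewtonPuiseux_holds`): for
`b₁, …, b_s ∈ \overline{k(x)}`, `k` algebraically closed of characteristic zero, there are
`N ≥ 1` and Laurent series `p₁, …, p_s ∈ k((t))` such that every polynomial relation
`G(x, b) = 0` over `k` implies `G(tᴺ, p) = 0`. [folklore] -/
theorem exists_laurent_relation_transfer [IsAlgClosed k] [CharZero k] {s : ℕ}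
    (b : Fin s → (AlgebraicClosure (FractionRing (MvPolynomial (Fin 1) k)))) :
    ∃ N : ℕ, 0 < N ∧ ∃ p : Fin s → LaurentSeries k,
      ∀ G : MvPolynomial (Fin 1 ⊕ Fin s) k,
        MvPolynomial.aeval (Sum.elim (fun v => algebraMap (MvPolynomial (Fin 1) k)
          (AlgebraicClosure (FractionRing (MvPolynomial (Fin 1) k))) (MvPolynomial.X v)) b)
            G = 0 →
        MvPolynomial.aeval (Sum.elim (fun _ => single (N : ℤ) (1 : k)) p) G = 0 := by
  classical
  obtain ⟨ι, hιX, hιC⟩ := exists_ringHom_fractionRing_laurentSeries (k := k)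
  -- the minimal polynomials of the `b j`, mapped to `k((x))[T]`, split after a common `x = tᴺ`
  have hint : ∀ j, IsIntegral (FractionRing (MvPolynomial (Fin 1) k)) (b j) :=
    fun j => Algebra.IsIntegral.isIntegral (b j)
  set P : (LaurentSeries k)[X] :=
    ∏ j, (minpoly (FractionRing (MvPolynomial (Fin 1) k)) (b j)).map ι with hP
  obtain ⟨N, hN, hsplit⟩ := Literature.FieldTheory.AlgClosed.NewtonPuiseux_holds k P
  have hP0 : P ≠ 0 := by
    rw [hP]
    exact Finset.prod_ne_zero_iff.mpr fun j _ =>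
      Polynomial.map_ne_zero (minpoly.ne_zero (hint j))
  set ιN : FractionRing (MvPolynomial (Fin 1) k) →+* LaurentSeries k :=
    (ramify k N hN).comp ι with hιN
  letI : Algebra (FractionRing (MvPolynomial (Fin 1) k)) (LaurentSeries k) := ιN.toAlgebra
  have halg : (algebraMap (FractionRing (MvPolynomial (Fin 1) k)) (LaurentSeries k) :
      FractionRing (MvPolynomial (Fin 1) k) →+* LaurentSeries k) = ιN := rfl
  have hK : ∀ x ∈ Set.range b, IsIntegral (FractionRing (MvPolynomial (Fin 1) k)) x ∧
      ((minpoly (FractionRing (MvPolynomial (Fin 1) k)) x).map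
        (algebraMap (FractionRing (MvPolynomial (Fin 1) k)) (LaurentSeries k))).Splits := by
    rintro _ ⟨j, rfl⟩
    refine ⟨hint j, ?_⟩
    rw [halg, hιN, ← Polynomial.map_map]
    refine Polynomial.Splits.of_dvd hsplit
      ((Polynomial.map_ne_zero_iff (ramify k N hN).injective).mpr hP0) ?_
    exact Polynomial.map_dvd _ (Finset.dvd_prod_of_mem _ (Finset.mem_univ j))
  -- hence `k(x)(b₁, …, b_s)` embeds into `k((t))` over `x ↦ tᴺ`
  obtain ⟨ψ⟩ := IntermediateField.nonempty_algHom_adjoin_of_splits hK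
  set E := IntermediateField.adjoin (FractionRing (MvPolynomial (Fin 1) k)) (Set.range b) with hE
  have hbE : ∀ j, b j ∈ E :=
    fun j => IntermediateField.subset_adjoin (FractionRing (MvPolynomial (Fin 1) k)) _ ⟨j, rfl⟩
  set b' : Fin s → E := fun j => ⟨b j, hbE j⟩ with hb'
  refine ⟨N, hN, fun j => ψ (b' j), fun G hG => ?_⟩
  -- pass to coefficients in `k(x)`
  set G' : MvPolynomial (Fin 1 ⊕ Fin s) (FractionRing (MvPolynomial (Fin 1) k)) :=
    MvPolynomial.map (algebraMap k (FractionRing (MvPolynomial (Fin 1) k))) G with hG'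
  set y : Fin 1 ⊕ Fin s → E :=
    Sum.elim (fun v => algebraMap (FractionRing (MvPolynomial (Fin 1) k)) E
      (algebraMap (MvPolynomial (Fin 1) k) (FractionRing (MvPolynomial (Fin 1) k))
        (MvPolynomial.X v))) b' with hy
  -- (1) the relation holds in `E` (checked inside the algebraic closure, where it is `hG`)
  have hval : (fun i => E.val (y i)) =
      Sum.elim (fun v => algebraMap (MvPolynomial (Fin 1) k)
        (AlgebraicClosure (FractionRing (MvPolynomial (Fin 1) k))) (MvPolynomial.X v)) b := by
    funext i
    rcases i with v | j
    · simp only [hy, Sum.elim_inl, IntermediateField.coe_val,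
        IntermediateField.coe_algebraMap_apply]
      exact (IsScalarTower.algebraMap_apply (MvPolynomial (Fin 1) k)
        (FractionRing (MvPolynomial (Fin 1) k))
        (AlgebraicClosure (FractionRing (MvPolynomial (Fin 1) k))) _).symm
    · rfl
  have h1 : MvPolynomial.aeval y G' = 0 := by
    apply (E.val).toRingHom.injective
    change E.val _ = E.val 0
    rw [map_zero, ← AlgHom.comp_apply, MvPolynomial.comp_aeval, hval, hG',
      MvPolynomial.aeval_map_algebraMap]
    exact hG
  -- (2) apply `ψ`
  have h2 : MvPolynomial.aeval (fun i => ψ (y i)) G' = 0 := by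
    rw [← MvPolynomial.comp_aeval, AlgHom.comp_apply, h1, map_zero]
  have hψy : (fun i => ψ (y i)) =
      Sum.elim (fun _ => single (N : ℤ) (1 : k)) (fun j => ψ (b' j)) := by
    funext i
    rcases i with v | j
    · simp only [hy, Sum.elim_inl, AlgHom.commutes, halg, hιN, RingHom.comp_apply]
      rw [hιX, ramify_single, mul_one]
    · rfl
  rw [hψy] at h2
  -- (3) back to coefficients in `k`
  have hιNk : ιN.comp (algebraMap k (FractionRing (MvPolynomial (Fin 1) k))) =
      algebraMap k (LaurentSeries k) := by
    refine RingHom.ext fun c => ?_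
    rw [RingHom.comp_apply, hιN, RingHom.comp_apply,
      IsScalarTower.algebraMap_apply k (MvPolynomial (Fin 1) k)
        (FractionRing (MvPolynomial (Fin 1) k)), MvPolynomial.algebraMap_eq, hιC,
      HahnSeries.C_apply, ramify_single, mul_zero, ← HahnSeries.C_apply]
    exact (LaurentSeries.algebraMap_apply (K := k) c).symm
  have h3 : MvPolynomial.aeval (R := (FractionRing (MvPolynomial (Fin 1) k)))
      (Sum.elim (fun _ => single (N : ℤ) (1 : k)) (fun j => ψ (b' j))) G' =
      MvPolynomial.aeval (Sum.elim (fun _ => single (N : ℤ) (1 : k)) (fun j => ψ (b' j))) G := by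
    rw [MvPolynomial.aeval_def, MvPolynomial.aeval_def, hG', MvPolynomial.eval₂_map, halg, hιNk]
  rw [h3] at h2
  exact h2

/-- Settles item `stmt-ValiantsHypothesis-7396` (`NumericToPuiseux`, route `BinomialElusive`):
if the binomial curve `x ↦ (x^{a_i} + x^{b_i})_i` lies in the image of a polynomial map
`Γ : ℂ^s → ℂ^m`, then for some `N ≥ 1` there are Laurent series `p ∈ ℂ((t))^s` with
`Γ(p) = (t^{N a_i} + t^{N b_i})_i`. Proof: GMOW 2019 Prop. 3.3 (`GMOW2019_prop33_holds`,
Nullstellensatz) gives algebraic functions `b(x) ∈ \overline{ℂ(x)}^s` with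
`Γ(b(x)) = (x^{a_i} + x^{b_i})_i`; the Puiseux parametrisation
`exists_laurent_relation_transfer` (Newton–Puiseux) specialises this identity along
`x ↦ tᴺ`, `b ↦ p(t)`. [folklore] -/
theorem numericToPuiseux_proof :
    Summit.ValiantsHypothesis.ValiantsHypothesis.Theses.BinomialElusive.NumericToPuiseux := by
  intro m s a b Γ _ hsub
  classical
  -- the curve as a polynomial map `ℂ¹ → ℂ^m`
  set L : Fin m → MvPolynomial (Fin 1) ℂ :=
    fun i => MvPolynomial.X 0 ^ a i + MvPolynomial.X 0 ^ b i with hL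
  have hLM : ∀ β : Fin 1 → ℂ, ∃ γ : Fin s → ℂ, ∀ i,
      MvPolynomial.eval β (L i) = MvPolynomial.eval γ (Γ i) := by
    intro β
    obtain ⟨y, hy⟩ := hsub ⟨β 0, rfl⟩
    refine ⟨y, fun i => ?_⟩
    rw [show MvPolynomial.eval y (Γ i) = β 0 ^ a i + β 0 ^ b i from congr_fun hy i]
    simp [hL]
  obtain ⟨bb, hbb⟩ := Literature.Barriers.ValiantsHypothesis.GMOW2019_prop33_holds ℂ (Fin 1)
    (Fin s) (Fin m) L Γ hLM
  obtain ⟨N, hN, p, hp⟩ := exists_laurent_relation_transfer bb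
  refine ⟨N, p, hN, fun i => ?_⟩
  have key := hp (MvPolynomial.rename Sum.inl (L i) - MvPolynomial.rename Sum.inr (Γ i)) (by
    rw [map_sub, MvPolynomial.aeval_rename, MvPolynomial.aeval_rename, sub_eq_zero,
      Sum.elim_comp_inl, Sum.elim_comp_inr,
      Literature.Barriers.ValiantsHypothesis.aeval_algebraMap_X_eq]
    exact hbb i)
  rw [map_sub, MvPolynomial.aeval_rename, MvPolynomial.aeval_rename, sub_eq_zero,
    Sum.elim_comp_inl, Sum.elim_comp_inr] at key
  rw [← key]
  simp only [hL, map_add, map_pow, MvPolynomial.aeval_X, HahnSeries.single_pow, one_pow]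
  push_cast
  rw [nsmul_eq_mul, nsmul_eq_mul, mul_comm (a i : ℤ), mul_comm (b i : ℤ)]

end Summit.ValiantsHypothesis.Theorems
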